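import Literature.Analysis.FluidPDE.FluidComputer.ThresholdGate
import Literature.Analysis.FluidPDE.FluidComputer.ReachCertificate
import HarnessLib

/-!
# Fluid computer blueprint — the threshold gate's CROSSING stage (clock through the threshold band)

HONEST FRAMING: low prior, high value-of-information experiment on Tao's machine paradigm; NOT a
claim that NS blows up. Everything in this file is finite-dimensional ODE theory about a circuit
DESIGN assembled from Tao's quadratic gates (J. Amer. Math. Soc. 29 (2016), §5); nothing is
asserted about the Euler or Navier–Stokes equations.

## The gap this file closes

For the threshold gate `thresholdCircuit ε σ ν μ r κ` (`ThresholdGate.lean`) two regimes of the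
trigger's net rate `ρ = νb - μa` (`triggerRate`) are theorems: BEFORE the threshold band, with
margin `λ = μa₀ - ν·sup b > 0`, the trigger FORGETS seed and forcing
(`IsPreThresholdCurve.trigger_abs_le`, the AVOID half with linear budgets); AFTER it, with floor
`ρ ≥ ρ₁ = νb(0) - μR > 0`, a forcing below the seed cannot hold the trigger
(`IsPreThresholdCurve.ignition_time_le`). In between the clock `b` must CROSS the band
`[μa₀/ν, μR/ν]` where the rate changes sign. This file certifies that stage.

The point is quantitative: inside the band the rate is SMALL, `|ρ| ≤ Λ` with `Λ` of the order of
`μ(R - a₀) + ν·(clock drift over the stage)` (`abs_triggerRate_le_of_band`) — not of the order of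
the naive `νR + μR` — so over the short crossing time the trigger grows at most by the factor
`e^{Λt}` from its pre-threshold level: `|c(t)| ≤ (|c(0)| + (σR² + δ)t)·e^{Λt}`
(`IsPreThresholdCurve.trigger_abs_le_affine`, Grönwall in the affine form
`abs_le_of_abs_deriv_right_le_affine`). Because the band in turn is controlled by the trigger level
(the clock's lower drift is `νC² + δ`), the stage bound is a BOOTSTRAP
(`IsPreThresholdCurve.crossing_trigger_le`, by the maximal-time exit principle of
`ODE/MaximalTime.lean`): if `Λ` dominates the two band expressions computed with trigger level `C`
and `(C₁ + (σR² + δ)T)e^{ΛT} < C`, then `|c| ≤ C` on the whole stage. All hypotheses are explicit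
polynomial–exponential inequalities in the design constants, and every budget stays LINEAR in the
seed `σ`, the defect `δ` and the offsets, times the factor `e^{ΛT}`.

## Packaging

`boxTube … C X₀ t` is the pre-threshold tube of `ThresholdGate.lean` with the trigger bound
replaced by a prescribed level `C` (`preTube_eq_boxTube`); `IsPreThresholdCurve.mem_boxTube` is
tube membership given `|c| ≤ C` (carrier, two-sided clock, output pair, energy — the §4 lemmas of
`ThresholdGate.lean`, which never used the margin); `boxTube_subset_preRegion` keeps the tube in the
working region under two explicit inequalities; and `crossingCertificate` is the stage as an
inhabitant of the reach layer's interface `ReachCertificate` (working region `preRegion a₀ R`,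
defect `δ`, stage length `T`, hand-off region `crossHandoff` = the boxes at time `T`), ready to be
composed after the pre-threshold stage and before the ignition stage
(`CertificateComposition.lean`, `ReachCertificate.comp`).

## What it is NOT

Not the ignition stage as a certificate and not the transfer stage (rotor sweep + drain under
forcing): those remain open here exactly as recorded in `ThresholdGate.lean`; and nothing
fluid-side. [cite: Tao2016AveragedNS, §5.5 Thm 5.3 (5.5); §1.3 pp. 10–11]
-/

noncomputable section

open Set Filter Topology
open scoped NNReal

namespace Literature.Analysis.FluidPDE.FluidComputer

open Literature.Analysis.FluidPDE.Tao2016AveragedNS Literature.Analysis.ODE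

variable {ε σ ν μ r κ δ a₀ R T : ℝ} {Y : ℝ → Fin 5 → ℝ}

/-! ### §1. Box tubes with a prescribed trigger level -/

/-- The **box tube** at time `t` about `X₀` with trigger level `C`: carrier `≥ a₀`; clock within
`[b₀ - (νC² + δ)t, b₀ + (εR² + δ)t]`; `|c| ≤ C`; output pair `≤ √(d₀² + ã₀²) + (rRC + 2δ)t`; energy
drift `≤ 10δR·t`. [folklore] -/
def boxTube (ε ν r δ a₀ R C : ℝ) (X₀ : Fin 5 → ℝ) (t : ℝ) : Set (Fin 5 → ℝ) :=
  {X | a₀ ≤ X 0 ∧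
    X₀ 1 - (ν * C ^ 2 + δ) * t ≤ X 1 ∧
    X 1 ≤ X₀ 1 + (ε * R ^ 2 + δ) * t ∧
    |X 2| ≤ C ∧
    Real.sqrt (X 3 ^ 2 + X 4 ^ 2) ≤ Real.sqrt (X₀ 3 ^ 2 + X₀ 4 ^ 2) + (r * R * C + 2 * δ) * t ∧
    |energy X - energy X₀| ≤ 10 * (δ * R) * t}

/-- The pre-threshold tube of `ThresholdGate.lean` IS the box tube at the level `triggerBound`.
[folklore] -/
theorem preTube_eq_boxTube (ε σ ν μ r δ a₀ R T : ℝ) (X₀ : Fin 5 → ℝ) (t : ℝ) :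
    preTube ε σ ν μ r δ a₀ R T X₀ t =
      boxTube ε ν r δ a₀ R (triggerBound ε σ ν μ δ a₀ R T X₀) X₀ t := rfl

/-- The initial state lies in its own box at time `0`. [folklore] -/
theorem self_mem_boxTube_zero {C : ℝ} (X₀ : Fin 5 → ℝ) (ha : a₀ ≤ X₀ 0) (hc : |X₀ 2| ≤ C) :
    X₀ ∈ boxTube ε ν r δ a₀ R C X₀ 0 := by
  simp only [boxTube, Set.mem_setOf_eq, mul_zero, sub_zero, add_zero, sub_self, abs_zero]
  exact ⟨ha, le_rfl, le_rfl, hc, le_rfl, le_rfl⟩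

/-- **Closed graph** of the box tube over `[0, T]`. [folklore] -/
theorem isClosed_boxTube_graph (C T : ℝ) (X₀ : Fin 5 → ℝ) :
    IsClosed {z : ℝ × (Fin 5 → ℝ) | z.1 ∈ Icc 0 T ∧ z.2 ∈ boxTube ε ν r δ a₀ R C X₀ z.1} := by
  have hE : Continuous (energy : (Fin 5 → ℝ) → ℝ) := by unfold energy; fun_prop
  have hX : ∀ i : Fin 5, Continuous fun z : ℝ × (Fin 5 → ℝ) => z.2 i :=
    fun i => (continuous_apply i).comp continuous_snd
  have hEz : Continuous fun z : ℝ × (Fin 5 → ℝ) => energy z.2 := hE.comp continuous_snd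
  have h0 := hX 0; have h1 := hX 1; have h2 := hX 2; have h3 := hX 3; have h4 := hX 4
  simp only [boxTube, Set.mem_Icc, Set.setOf_and]
  refine ((isClosed_le continuous_const continuous_fst).inter
    (isClosed_le continuous_fst continuous_const)).inter
    ((isClosed_le continuous_const h0).inter
    ((isClosed_le (by fun_prop) h1).inter
    ((isClosed_le h1 (by fun_prop)).inter
    ((isClosed_le (by fun_prop) continuous_const).inter
    ((isClosed_le (by fun_prop) (by fun_prop)).inter
    (isClosed_le (by fun_prop) (by fun_prop)))))))

/-- **The box tube lies in the working region** `preRegion a₀ R` under two explicit inequalities: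
the energy budget keeps every mode below `R`, and energy conservation up to the linear drift keeps
the carrier STRICTLY above `a₀` as long as clock, trigger and output boxes are small in energy.
[folklore] -/
theorem boxTube_subset_preRegion {ε ν r δ a₀ R C T t : ℝ} {X₀ : Fin 5 → ℝ}
    (hε : 0 ≤ ε) (hν : 0 ≤ ν) (hr : 0 ≤ r) (hδ : 0 ≤ δ) (hR : 0 ≤ R) (hC : 0 ≤ C)
    (ht : t ∈ Icc 0 T) (hER : energy X₀ + 10 * (δ * R) * T < R ^ 2)
    (hEa : a₀ ^ 2 + 10 * (δ * R) * T +
        max |X₀ 1 - (ν * C ^ 2 + δ) * T| |X₀ 1 + (ε * R ^ 2 + δ) * T| ^ 2 + C ^ 2 +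
        (Real.sqrt (X₀ 3 ^ 2 + X₀ 4 ^ 2) + (r * R * C + 2 * δ) * T) ^ 2 < energy X₀) :
    boxTube ε ν r δ a₀ R C X₀ t ⊆ preRegion a₀ R := by
  intro X hX
  simp only [boxTube, Set.mem_setOf_eq] at hX
  obtain ⟨h0, hblo, hbhi, hc, hS, hE⟩ := hX
  set k := r * R * C + 2 * δ with hk_def
  set S₀ := Real.sqrt (X₀ 3 ^ 2 + X₀ 4 ^ 2) with hS₀_def
  set Bm := max |X₀ 1 - (ν * C ^ 2 + δ) * T| |X₀ 1 + (ε * R ^ 2 + δ) * T| with hBm_def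
  have hk : 0 ≤ k := by rw [hk_def]; positivity
  clear_value k S₀ Bm
  have hEt := abs_le.1 hE
  have hδRt : 10 * (δ * R) * t ≤ 10 * (δ * R) * T :=
    mul_le_mul_of_nonneg_left ht.2 (by positivity)
  show a₀ < X 0 ∧ ∀ i, |X i| < R
  constructor
  · have hb : |X 1| ≤ Bm := by
      have h1 : (ν * C ^ 2 + δ) * t ≤ (ν * C ^ 2 + δ) * T :=
        mul_le_mul_of_nonneg_left ht.2 (by positivity)
      have h2 : (ε * R ^ 2 + δ) * t ≤ (ε * R ^ 2 + δ) * T :=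
        mul_le_mul_of_nonneg_left ht.2 (by positivity)
      rw [hBm_def]
      exact abs_le_max_abs_abs (by linarith) (by linarith)
    have hb2 : X 1 ^ 2 ≤ Bm ^ 2 := by nlinarith [hb, abs_nonneg (X 1), sq_abs (X 1)]
    have hc2 : X 2 ^ 2 ≤ C ^ 2 := by nlinarith [hc, abs_nonneg (X 2), sq_abs (X 2)]
    have hP : X 3 ^ 2 + X 4 ^ 2 ≤ (S₀ + k * T) ^ 2 := by
      have hkt : k * t ≤ k * T := mul_le_mul_of_nonneg_left ht.2 hk
      have hs0 : 0 ≤ Real.sqrt (X 3 ^ 2 + X 4 ^ 2) := Real.sqrt_nonneg _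
      have hsq := Real.sq_sqrt (show 0 ≤ X 3 ^ 2 + X 4 ^ 2 by positivity)
      have hS' : Real.sqrt (X 3 ^ 2 + X 4 ^ 2) ≤ S₀ + k * T := by linarith
      nlinarith [hS', hs0, hsq]
    have hsq := carrier_sq_eq X
    have hX0sq : a₀ ^ 2 < X 0 ^ 2 := by linarith [hsq, hEt.1, hδRt, hb2, hc2, hP, hEa]
    exact lt_of_le_of_ne h0 fun heq => by rw [heq] at hX0sq; exact lt_irrefl _ hX0sq
  · intro i
    have hi2 : X i ^ 2 ≤ energy X := sq_apply_le_energy X i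
    have hlt : X i ^ 2 < R ^ 2 := by linarith [hEt.2, hδRt, hER]
    exact abs_lt_of_sq_lt_sq hlt hR

namespace IsPreThresholdCurve

/-- Shortening the horizon. [folklore] -/
theorem mono_horizon (h : IsPreThresholdCurve ε σ ν μ r κ δ a₀ R T Y) {T' : ℝ} (hT' : T' ≤ T) :
    IsPreThresholdCurve ε σ ν μ r κ δ a₀ R T' Y :=
  ⟨h.continuousOn.mono (Icc_subset_Icc_right hT'),
    fun t ht => h.mem t ⟨ht.1, ht.2.trans_le hT'⟩,
    fun t ht => h.defect t ⟨ht.1, ht.2.trans_le hT'⟩⟩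

/-- **Box membership from a trigger level.** If `|c| ≤ C` on `[0,T)` then the curve lies in
`boxTube … C (Y 0) t` at every `t ∈ [0,T]`: carrier (`carrier_ge`), clock (`clock_ge`, `clock_le`),
trigger (closure), output pair (`output_sqrt_le`), energy (`energy_abs_sub_le`) — the §4 lemmas of
`ThresholdGate.lean`, none of which uses the pre-threshold margin.
[cite: Tao2016AveragedNS, §5.5 (5.5)] -/
theorem mem_boxTube (h : IsPreThresholdCurve ε σ ν μ r κ δ a₀ R T Y)
    (hε : 0 ≤ ε) (hν : 0 ≤ ν) (hr : 0 ≤ r) (hδ : 0 ≤ δ) (hT : 0 < T)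
    {C : ℝ} (hC0 : 0 ≤ C) (hC : ∀ t ∈ Ico 0 T, |Y t 2| ≤ C) :
    ∀ t ∈ Icc 0 T, Y t ∈ boxTube ε ν r δ a₀ R C (Y 0) t := by
  have h0 := h.carrier_ge hT
  have h1 := h.clock_ge hε hν hC
  have h2 := h.clock_le hε hν
  have h4 := h.output_sqrt_le hr hδ hC0 hC
  have h5 := h.energy_abs_sub_le
  have hg : ContinuousOn (fun τ => |Y τ 2|) (Icc 0 T) :=
    ((continuous_apply 2).comp_continuousOn h.continuousOn).abs
  have hcC : ∀ t ∈ Icc 0 T, |Y t 2| ≤ C := by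
    intro t ht
    rcases eq_or_lt_of_le ht.1 with h00 | ht0
    · subst h00; exact hC 0 ⟨le_rfl, hT⟩
    · exact le_const_of_forall_Ico hg ⟨ht0, ht.2⟩ fun s hs => hC s ⟨hs.1, hs.2.trans_le ht.2⟩
  intro t ht
  exact ⟨h0 t ht, h1 t ht, h2 t ht, hcC t ht, h4 t ht, h5 t ht⟩

/-! ### §2. The rate in the band and the affine Grönwall bound -/

/-- **The affine Grönwall bound on the trigger.** If the net rate is two-sidedly bounded,
`|ρ(Y t)| ≤ Λ` on `[0,T)`, then `|c(t)| ≤ (|c(0)| + (σR² + δ)t)·e^{Λt}` on `[0,T]`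
(`|ċ| ≤ σR² + δ + Λ|c|`, `abs_le_of_abs_deriv_right_le_affine`).
[cite: Tao2016AveragedNS, §5.5 (5.5); §5.3 (amp)] -/
theorem trigger_abs_le_affine (h : IsPreThresholdCurve ε σ ν μ r κ δ a₀ R T Y) (hσ : 0 ≤ σ)
    (hδ : 0 ≤ δ) {Λ : ℝ} (hΛ : 0 ≤ Λ) (hρ : ∀ t ∈ Ico 0 T, |triggerRate ν μ (Y t)| ≤ Λ) :
    ∀ t ∈ Icc 0 T, |Y t 2| ≤ (|Y 0 2| + (σ * R ^ 2 + δ) * t) * Real.exp (Λ * t) := by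
  choose! V hV hVδ using h.defect
  have hc : ContinuousOn (fun τ => Y τ 2) (Icc 0 T) :=
    (continuous_apply 2).comp_continuousOn h.continuousOn
  have hd : ∀ τ ∈ Ico 0 T, HasDerivWithinAt (fun τ => Y τ 2) (V τ 2) (Ici τ) τ :=
    fun τ hτ => (hasDerivWithinAt_pi.1 (hV τ hτ)) 2
  have hb : ∀ τ ∈ Ico 0 T, |V τ 2| ≤ (σ * R ^ 2 + δ) + Λ * |Y τ 2| := by
    intro τ hτ
    obtain ⟨-, hall⟩ := h.mem τ hτ
    have haR := abs_le.1 (hall 0).le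
    have ha2 : Y τ 0 ^ 2 ≤ R ^ 2 := sq_le_sq' haR.1 haR.2
    have hg := abs_apply_le_of_norm_le (hVδ τ hτ) 2
    rw [Pi.sub_apply, thresholdCircuit_trigger] at hg
    have hρc : |triggerRate ν μ (Y τ) * Y τ 2| ≤ Λ * |Y τ 2| := by
      rw [abs_mul]; exact mul_le_mul_of_nonneg_right (hρ τ hτ) (abs_nonneg _)
    have hσa : |σ * Y τ 0 ^ 2| ≤ σ * R ^ 2 := by
      rw [abs_of_nonneg (by positivity)]; exact mul_le_mul_of_nonneg_left ha2 hσ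
    have e : V τ 2 = (V τ 2 - (σ * Y τ 0 ^ 2 + triggerRate ν μ (Y τ) * Y τ 2)) +
        σ * Y τ 0 ^ 2 + triggerRate ν μ (Y τ) * Y τ 2 := by ring
    calc |V τ 2| = |(V τ 2 - (σ * Y τ 0 ^ 2 + triggerRate ν μ (Y τ) * Y τ 2)) +
          σ * Y τ 0 ^ 2 + triggerRate ν μ (Y τ) * Y τ 2| := congrArg abs e
      _ ≤ |V τ 2 - (σ * Y τ 0 ^ 2 + triggerRate ν μ (Y τ) * Y τ 2)| + |σ * Y τ 0 ^ 2| +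
          |triggerRate ν μ (Y τ) * Y τ 2| := abs_add_three _ _ _
      _ ≤ δ + σ * R ^ 2 + Λ * |Y τ 2| := by linarith
      _ = σ * R ^ 2 + δ + Λ * |Y τ 2| := by ring
  intro t ht
  have := abs_le_of_abs_deriv_right_le_affine hc hd (by positivity) hΛ hb t ht
  simpa using this

end IsPreThresholdCurve

/-- **The rate is small in the band.** For a state of the working region (`a₀ < a`, `|a| < R`)
whose clock lies in `[B₁, B₂]`: `|νb - μa| ≤ Λ` as soon as `νB₂ - μa₀ ≤ Λ` and `μR - νB₁ ≤ Λ`.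
In the crossing band `B₁ ≈ μa₀/ν`, `B₂ ≈ μR/ν` this is `Λ ≈ μ(R - a₀)`: SMALL, although each of
`νb`, `μa` is large. [cite: Tao2016AveragedNS, §5.5 (5.5)] -/
theorem abs_triggerRate_le_of_band {ν μ a₀ R B₁ B₂ Λ : ℝ} (hν : 0 ≤ ν) (hμ : 0 ≤ μ)
    {X : Fin 5 → ℝ} (hX : X ∈ preRegion a₀ R) (hb₁ : B₁ ≤ X 1) (hb₂ : X 1 ≤ B₂)
    (h1 : ν * B₂ - μ * a₀ ≤ Λ) (h2 : μ * R - ν * B₁ ≤ Λ) : |triggerRate ν μ X| ≤ Λ := by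
  obtain ⟨ha, hall⟩ := hX
  have haR := (abs_lt.1 (hall 0)).2
  rw [triggerRate, abs_le]
  constructor
  · have e1 := mul_le_mul_of_nonneg_left haR.le hμ
    have e2 := mul_le_mul_of_nonneg_left hb₁ hν
    linarith
  · have e1 := mul_le_mul_of_nonneg_left ha.le hμ
    have e2 := mul_le_mul_of_nonneg_left hb₂ hν
    linarith

namespace IsPreThresholdCurve

/-! ### §3. The crossing bound (bootstrap) -/

/-- **THE CROSSING STAGE.** Let the curve satisfy the three `cert` hypotheses in `preRegion a₀ R`
on `[0,T]`, start with `|c(0)| ≤ C₁`, and let `Λ ≥ 0`, `C` satisfy the closed system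
`ν(b(0) + (εR² + δ)T) - μa₀ ≤ Λ`, `μR - ν(b(0) - (νC² + δ)T) ≤ Λ` (the band computed with trigger
level `C` has rate at most `Λ`) and `(C₁ + (σR² + δ)T)·e^{ΛT} < C` (the affine Grönwall bound with
rate `Λ` stays below `C`). Then `|c| ≤ C` on all of `[0,T]`. Proof: bootstrap on the maximal time
of the closed condition `|c| ≤ C` (`maximalTimeP`): up to it the clock lies in the band
(`clock_ge`, `clock_le`), so `|ρ| ≤ Λ` (`abs_triggerRate_le_of_band`), so the trigger obeys the
affine bound (`trigger_abs_le_affine`), which is `< C`; by the exit principle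
(`eq_of_maximalTimeP_le_const_lt`) the maximal time is `T`.
[cite: Tao2016AveragedNS, §5.5 Thm 5.3 (5.5)] -/
theorem crossing_trigger_le (h : IsPreThresholdCurve ε σ ν μ r κ δ a₀ R T Y)
    (hε : 0 ≤ ε) (hσ : 0 ≤ σ) (hν : 0 ≤ ν) (hμ : 0 ≤ μ) (hδ : 0 ≤ δ) (hT : 0 ≤ T)
    {C₁ C Λ : ℝ} (hΛ : 0 ≤ Λ) (hc0 : |Y 0 2| ≤ C₁)
    (h1 : ν * (Y 0 1 + (ε * R ^ 2 + δ) * T) - μ * a₀ ≤ Λ)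
    (h2 : μ * R - ν * (Y 0 1 - (ν * C ^ 2 + δ) * T) ≤ Λ)
    (h3 : (C₁ + (σ * R ^ 2 + δ) * T) * Real.exp (Λ * T) < C) :
    ∀ t ∈ Icc 0 T, |Y t 2| ≤ C := by
  have hC₁ : 0 ≤ C₁ := (abs_nonneg _).trans hc0
  have hK : 0 ≤ σ * R ^ 2 + δ := by positivity
  have hbound : ∀ t ∈ Icc 0 T, (C₁ + (σ * R ^ 2 + δ) * t) * Real.exp (Λ * t) < C := by
    intro t ht
    refine lt_of_le_of_lt ?_ h3
    have e1 : (σ * R ^ 2 + δ) * t ≤ (σ * R ^ 2 + δ) * T := mul_le_mul_of_nonneg_left ht.2 hK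
    have e2 : Real.exp (Λ * t) ≤ Real.exp (Λ * T) :=
      Real.exp_le_exp.2 (mul_le_mul_of_nonneg_left ht.2 hΛ)
    exact mul_le_mul (by linarith) e2 (Real.exp_pos _).le (by positivity)
  have hg : ContinuousOn (fun τ => |Y τ 2|) (Icc 0 T) :=
    ((continuous_apply 2).comp_continuousOn h.continuousOn).abs
  have hg0 : |Y 0 2| ≤ C := by
    have := hbound 0 ⟨le_rfl, hT⟩
    simp only [mul_zero, add_zero, Real.exp_zero, mul_one] at this
    linarith
  set t₁ := maximalTimeP (fun s => |Y s 2| ≤ C) 0 T with ht₁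
  have ht₁mem : t₁ ∈ Icc 0 T := maximalTimeP_le_const_mem hT hg0
  have hspec : ∀ t ∈ Icc 0 t₁, |Y t 2| ≤ C := fun t ht => maximalTimeP_le_const_spec hT hg hg0 ht
  suffices hEq : t₁ = T by rw [← hEq]; exact hspec
  by_contra hne
  have hlt : t₁ < T := lt_of_le_of_ne ht₁mem.2 hne
  have hexit : |Y t₁ 2| = C := eq_of_maximalTimeP_le_const_lt hT hg hg0 hlt
  have h' := h.mono_horizon ht₁mem.2
  have hCt : ∀ t ∈ Ico 0 t₁, |Y t 2| ≤ C := fun t ht => hspec t (Ico_subset_Icc_self ht)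
  have hbhi := h'.clock_le hε hν
  have hblo := h'.clock_ge hε hν hCt
  have hρ : ∀ t ∈ Ico 0 t₁, |triggerRate ν μ (Y t)| ≤ Λ := by
    intro t ht
    have htT : t ≤ T := ht.2.le.trans ht₁mem.2
    have hk₂ : (ε * R ^ 2 + δ) * t ≤ (ε * R ^ 2 + δ) * T :=
      mul_le_mul_of_nonneg_left htT (by positivity)
    have hk₁ : (ν * C ^ 2 + δ) * t ≤ (ν * C ^ 2 + δ) * T :=
      mul_le_mul_of_nonneg_left htT (by positivity)
    refine abs_triggerRate_le_of_band hν hμ (h'.mem t ht) (hblo t (Ico_subset_Icc_self ht))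
      (hbhi t (Ico_subset_Icc_self ht)) ?_ ?_
    · have := mul_le_mul_of_nonneg_left hk₂ hν
      linarith
    · have := mul_le_mul_of_nonneg_left hk₁ hν
      linarith
  have haff := h'.trigger_abs_le_affine hσ hδ hΛ hρ t₁ ⟨ht₁mem.1, le_rfl⟩
  have hle : (|Y 0 2| + (σ * R ^ 2 + δ) * t₁) * Real.exp (Λ * t₁) ≤
      (C₁ + (σ * R ^ 2 + δ) * t₁) * Real.exp (Λ * t₁) :=
    mul_le_mul_of_nonneg_right (by linarith) (Real.exp_pos _).le
  have hlt' : |Y t₁ 2| < C := lt_of_le_of_lt (haff.trans hle) (hbound t₁ ht₁mem)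
  linarith [hexit]

/-- **The crossing stage in tube form.** Under the hypotheses of `crossing_trigger_le` (and `T > 0`,
`C ≥ 0`) the curve lies in `boxTube … C (Y 0) t` for every `t ∈ [0,T]`. [folklore] -/
theorem mem_boxTube_crossing (h : IsPreThresholdCurve ε σ ν μ r κ δ a₀ R T Y)
    (hε : 0 ≤ ε) (hσ : 0 ≤ σ) (hν : 0 ≤ ν) (hμ : 0 ≤ μ) (hr : 0 ≤ r) (hδ : 0 ≤ δ) (hT : 0 < T)
    {C₁ C Λ : ℝ} (hΛ : 0 ≤ Λ) (hc0 : |Y 0 2| ≤ C₁)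
    (h1 : ν * (Y 0 1 + (ε * R ^ 2 + δ) * T) - μ * a₀ ≤ Λ)
    (h2 : μ * R - ν * (Y 0 1 - (ν * C ^ 2 + δ) * T) ≤ Λ)
    (h3 : (C₁ + (σ * R ^ 2 + δ) * T) * Real.exp (Λ * T) < C) :
    ∀ t ∈ Icc 0 T, Y t ∈ boxTube ε ν r δ a₀ R C (Y 0) t := by
  have hC : ∀ t ∈ Icc 0 T, |Y t 2| ≤ C := h.crossing_trigger_le hε hσ hν hμ hδ hT.le hΛ hc0 h1 h2 h3
  have hC0 : 0 ≤ C := (abs_nonneg _).trans (hC 0 ⟨le_rfl, hT.le⟩)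
  exact h.mem_boxTube hε hν hr hδ hT hC0 fun t ht => hC t (Ico_subset_Icc_self ht)

end IsPreThresholdCurve

/-! ### §4. The crossing stage as a `ReachCertificate` -/

/-- The **hand-off region** of the crossing stage: the boxes `boxTube … C p T` at the end of the
stage, from the input readouts `p ∈ Ain` (ignition-ready: clock past the band). [folklore] -/
def crossHandoff (ε ν r δ a₀ R C T : ℝ) (Ain : Set (Fin 5 → ℝ)) : Set (Fin 5 → ℝ) :=
  {X | ∃ p ∈ Ain, X ∈ boxTube ε ν r δ a₀ R C p T}

/-- **The crossing stage of the threshold gate IS a robust reach–avoid certificate** of the reach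
layer's interface: design field `thresholdCircuit`, working region `preRegion a₀ R`, defect `δ`,
stage length `T > 0`, any input region `Ain` of loaded readouts (`a₀ ≤ p 0`) satisfying the three
crossing inequalities of `crossing_trigger_le` with `C₁ = |p 2|` (rate `Λ ≥ 0` dominating the band
at trigger level `C`; affine Grönwall bound `< C`), whose boxes stay in the working region
(discharge `hsub` with `boxTube_subset_preRegion`). Tube `= boxTube … C p` (no horizon dependence),
`cert` = `mem_boxTube_crossing` on the shorter window (the three inequalities are monotone in the
horizon), REACH at full stage = box membership at `T`. [cite: Tao2016AveragedNS, §5.5 Thm 5.3] -/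
def crossingCertificate (ε σ ν μ r κ δ a₀ R C Λ T : ℝ) (Ain : Set (Fin 5 → ℝ))
    (hε : 0 ≤ ε) (hσ : 0 ≤ σ) (hν : 0 ≤ ν) (hμ : 0 ≤ μ) (hr : 0 ≤ r) (hδ : 0 ≤ δ)
    (hT : 0 < T) (hΛ : 0 ≤ Λ)
    (hAin : ∀ p ∈ Ain, a₀ ≤ p 0 ∧
      ν * (p 1 + (ε * R ^ 2 + δ) * T) - μ * a₀ ≤ Λ ∧
      μ * R - ν * (p 1 - (ν * C ^ 2 + δ) * T) ≤ Λ ∧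
      (|p 2| + (σ * R ^ 2 + δ) * T) * Real.exp (Λ * T) < C)
    (hsub : ∀ p ∈ Ain, ∀ t ∈ Icc 0 T, boxTube ε ν r δ a₀ R C p t ⊆ preRegion a₀ R) :
    ReachCertificate (thresholdCircuit ε σ ν μ r κ) (preRegion a₀ R) δ T Ain
      (crossHandoff ε ν r δ a₀ R C T Ain) where
  Tube p t := boxTube ε ν r δ a₀ R C p t
  Tube_closed p _ := isClosed_boxTube_graph C T p
  Tube_zero p hp := by
    obtain ⟨ha, -, -, h3⟩ := hAin p hp
    refine self_mem_boxTube_zero p ha ?_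
    have hK : 0 ≤ (σ * R ^ 2 + δ) * T := by positivity
    have h1e : 1 ≤ Real.exp (Λ * T) := Real.one_le_exp (by positivity)
    nlinarith [abs_nonneg (p 2), h3, hK, h1e]
  Tube_sub p hp t ht := hsub p hp t ht
  cert p hp σT x h0 hσT hx0 hcont hU hder := by
    obtain ⟨ha, hb1, hb2, hb3⟩ := hAin p hp
    have hK : 0 ≤ σ * R ^ 2 + δ := by positivity
    have key : x σT ∈ boxTube ε ν r δ a₀ R C p σT := by
      rcases eq_or_lt_of_le h0 with h00 | hpos
      · subst h00
        rw [hx0]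
        refine self_mem_boxTube_zero p ha ?_
        have hKT : 0 ≤ (σ * R ^ 2 + δ) * T := by positivity
        have h1e : 1 ≤ Real.exp (Λ * T) := Real.one_le_exp (by positivity)
        nlinarith [abs_nonneg (p 2), hb3, hKT, h1e]
      · have hc : IsPreThresholdCurve ε σ ν μ r κ δ a₀ R σT x := ⟨hcont, hU, hder⟩
        -- the three inequalities at the shorter horizon σT
        have e₂ : (ε * R ^ 2 + δ) * σT ≤ (ε * R ^ 2 + δ) * T :=
          mul_le_mul_of_nonneg_left hσT (by positivity)
        have e₁ : (ν * C ^ 2 + δ) * σT ≤ (ν * C ^ 2 + δ) * T :=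
          mul_le_mul_of_nonneg_left hσT (by positivity)
        have h1' : ν * (x 0 1 + (ε * R ^ 2 + δ) * σT) - μ * a₀ ≤ Λ := by
          rw [hx0]; have := mul_le_mul_of_nonneg_left e₂ hν; linarith
        have h2' : μ * R - ν * (x 0 1 - (ν * C ^ 2 + δ) * σT) ≤ Λ := by
          rw [hx0]; have := mul_le_mul_of_nonneg_left e₁ hν; linarith
        have h3' : (|x 0 2| + (σ * R ^ 2 + δ) * σT) * Real.exp (Λ * σT) < C := by
          rw [hx0]
          refine lt_of_le_of_lt ?_ hb3
          have f1 : (σ * R ^ 2 + δ) * σT ≤ (σ * R ^ 2 + δ) * T := mul_le_mul_of_nonneg_left hσT hK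
          have f2 : Real.exp (Λ * σT) ≤ Real.exp (Λ * T) :=
            Real.exp_le_exp.2 (mul_le_mul_of_nonneg_left hσT hΛ)
          exact mul_le_mul (by linarith) f2 (Real.exp_pos _).le (by positivity)
        have hm := hc.mem_boxTube_crossing hε hσ hν hμ hr hδ hpos hΛ le_rfl h1' h2' h3' σT
          ⟨h0, le_rfl⟩
        rwa [hx0] at hm
    refine ⟨key, fun hEq => ?_⟩
    subst hEq
    exact ⟨σT, ⟨h0, le_rfl⟩, p, hp, key⟩

/-- The certificate's tube is the box tube (definitional unfolding). [folklore] -/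
theorem crossingCertificate_tube (ε σ ν μ r κ δ a₀ R C Λ T : ℝ) (Ain : Set (Fin 5 → ℝ))
    (hε : 0 ≤ ε) (hσ : 0 ≤ σ) (hν : 0 ≤ ν) (hμ : 0 ≤ μ) (hr : 0 ≤ r) (hδ : 0 ≤ δ)
    (hT : 0 < T) (hΛ : 0 ≤ Λ)
    (hAin : ∀ p ∈ Ain, a₀ ≤ p 0 ∧
      ν * (p 1 + (ε * R ^ 2 + δ) * T) - μ * a₀ ≤ Λ ∧
      μ * R - ν * (p 1 - (ν * C ^ 2 + δ) * T) ≤ Λ ∧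
      (|p 2| + (σ * R ^ 2 + δ) * T) * Real.exp (Λ * T) < C)
    (hsub : ∀ p ∈ Ain, ∀ t ∈ Icc 0 T, boxTube ε ν r δ a₀ R C p t ⊆ preRegion a₀ R)
    (p : Fin 5 → ℝ) (t : ℝ) :
    (crossingCertificate ε σ ν μ r κ δ a₀ R C Λ T Ain hε hσ hν hμ hr hδ hT hΛ hAin hsub).Tube p t =
      boxTube ε ν r δ a₀ R C p t := rfl

end Literature.Analysis.FluidPDE.FluidComputer

end
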